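import Mathlib.Analysis.SpecialFunctions.Sqrt
import Mathlib.Analysis.SpecialFunctions.Pow.Deriv
import Literature.NumberTheory.Transcendental.KZCalculusProofs

/-!
# Potentials of the Legendre modulus-propagation certificate (engine client L2)

Lines cusp-transport / hodge-locus of the crux `CompleteModGammaSector`
(stmt-KontsevichZagierPeriods-14233), first client of the certificate-transport engine E2':
Legendre modulus propagation. Stubs `stub_legendrePotentialX` and `stub_legendrePotentialY`.

For the Legendre family `F_m(x, y)` the modulus derivative is a divergence
`∂ₘ F = ∂ₓ G₁ + ∂_y G₂` with the potentials
`G₁ = ½ x √(1 − x²) y² / (√(1 − m x²) √(1 − y²) √(1 − (1 − m) y²))`,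
`G₂ = −½ x² y √(1 − y²) / (√(1 − x²) √(1 − m x²) √(1 − (1 − m) y²))`.
The engine needs, in each coordinate direction, that the potential is continuous on the closed
fibre `[0, 1]`, vanishes on both faces, and has the prescribed derivative `gᵢ` inside. Both
potentials are a constant multiple of the one-variable function
`φ_k(u) = u √(1 − u²) / √(1 − k u²)` (`k = m`, resp. `k = 1 − m`), whose elementary calculus on
`[0, 1]` is done once (`legendrePhi_continuousOn`, `legendrePhi_hasDerivAt`).
-/

noncomputable section
set_option linter.dupNamespace false

namespace Summit.KontsevichZagierPeriods.KontsevichZagierPeriods.CompleteModGammaSectorEngine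

open MeasureTheory Set
open Literature.NumberTheory.Transcendental
open Literature.NumberTheory.Transcendental.KZ

/-- For `0 < k < 1` and `u ∈ [0, 1]` one has `0 < 1 − k u²`. [folklore] -/
private theorem legendrePhi_den_pos {k u : ℝ} (hk : k ∈ Set.Ioo (0:ℝ) 1)
    (hu : u ∈ Set.Icc (0:ℝ) 1) :
    0 < 1 - k * u ^ 2 := by
  have hu2 : u ^ 2 ≤ 1 := pow_le_one₀ hu.1 hu.2
  have hku : k * u ^ 2 ≤ k := mul_le_of_le_one_right hk.1.le hu2
  linarith [hk.2]

/-- Continuity of `φ_k(u) = u √(1 − u²) / √(1 − k u²)` on `[0, 1]` for `0 < k < 1`. [folklore] -/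
private theorem legendrePhi_continuousOn {k : ℝ} (hk : k ∈ Set.Ioo (0:ℝ) 1) :
    ContinuousOn (fun u : ℝ => u * Real.sqrt (1 - u ^ 2) / Real.sqrt (1 - k * u ^ 2))
      (Set.Icc (0:ℝ) 1) := by
  refine ContinuousOn.div₀ (by fun_prop) (by fun_prop) ?_
  intro u hu
  exact Real.sqrt_ne_zero'.mpr (legendrePhi_den_pos hk hu)

/-- Derivative of `φ_k(u) = u √(1 − u²) / √(1 − k u²)` at an interior point `u ∈ (0, 1)`:
`φ_k'(u) = (1 / (√(1 − u²) √(1 − k u²))) · ((1 − 2u²) + k u² (1 − u²)/(1 − k u²))`. [folklore] -/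
private theorem legendrePhi_hasDerivAt {k : ℝ} (hk : k ∈ Set.Ioo (0:ℝ) 1) {u : ℝ}
    (hu : u ∈ Set.Ioo (0:ℝ) 1) :
    HasDerivAt (fun v : ℝ => v * Real.sqrt (1 - v ^ 2) / Real.sqrt (1 - k * v ^ 2))
      ((1 / (Real.sqrt (1 - u ^ 2) * Real.sqrt (1 - k * u ^ 2))) *
        ((1 - 2 * u ^ 2) + k * u ^ 2 * (1 - u ^ 2) / (1 - k * u ^ 2))) u := by
  have hA : 0 < 1 - u ^ 2 := by nlinarith [hu.1, hu.2]
  have hB : 0 < 1 - k * u ^ 2 := legendrePhi_den_pos hk (Ioo_subset_Icc_self hu)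
  have ha : 0 < Real.sqrt (1 - u ^ 2) := Real.sqrt_pos.mpr hA
  have hb : 0 < Real.sqrt (1 - k * u ^ 2) := Real.sqrt_pos.mpr hB
  have ha2 : Real.sqrt (1 - u ^ 2) ^ 2 = 1 - u ^ 2 := Real.sq_sqrt hA.le
  have hb2 : Real.sqrt (1 - k * u ^ 2) ^ 2 = 1 - k * u ^ 2 := Real.sq_sqrt hB.le
  -- inner functions
  have h1 : HasDerivAt (fun v : ℝ => 1 - v ^ 2) (-(2 * u)) u := by
    simpa using (hasDerivAt_pow 2 u).const_sub 1
  have h2 : HasDerivAt (fun v : ℝ => Real.sqrt (1 - v ^ 2)) (-u / Real.sqrt (1 - u ^ 2)) u := by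
    refine (h1.sqrt hA.ne').congr_deriv ?_
    rw [div_eq_div_iff (mul_ne_zero two_ne_zero ha.ne') ha.ne']
    ring
  have h3 : HasDerivAt (fun v : ℝ => 1 - k * v ^ 2) (-(k * (2 * u))) u := by
    simpa using ((hasDerivAt_pow 2 u).const_mul k).const_sub 1
  have h4 : HasDerivAt (fun v : ℝ => Real.sqrt (1 - k * v ^ 2))
      (-(k * u) / Real.sqrt (1 - k * u ^ 2)) u := by
    refine (h3.sqrt hB.ne').congr_deriv ?_
    rw [div_eq_div_iff (mul_ne_zero two_ne_zero hb.ne') hb.ne']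
    ring
  have h5 : HasDerivAt (fun v : ℝ => v * Real.sqrt (1 - v ^ 2))
      ((1 - 2 * u ^ 2) / Real.sqrt (1 - u ^ 2)) u := by
    refine ((hasDerivAt_id' u).mul h2).congr_deriv ?_
    rw [eq_div_iff ha.ne']
    calc (1 * Real.sqrt (1 - u ^ 2) + u * (-u / Real.sqrt (1 - u ^ 2))) * Real.sqrt (1 - u ^ 2)
        = Real.sqrt (1 - u ^ 2) ^ 2
            - u ^ 2 * (Real.sqrt (1 - u ^ 2) / Real.sqrt (1 - u ^ 2)) := by ring
      _ = 1 - 2 * u ^ 2 := by rw [div_self ha.ne', ha2]; ring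
  refine (h5.div h4 hb.ne').congr_deriv ?_
  have ha' : Real.sqrt (1 - u ^ 2) ≠ 0 := ha.ne'
  have hb' : Real.sqrt (1 - k * u ^ 2) ≠ 0 := hb.ne'
  set a := Real.sqrt (1 - u ^ 2) with ha_def
  set b := Real.sqrt (1 - k * u ^ 2) with hb_def
  rw [← ha2, ← hb2]
  field_simp
  ring

/-- **Potential `G₁`** of the Legendre certificate:
`G₁(u) = ½ u √(1 − u²) y² / (√(1 − m u²) √(1 − y²) √(1 − (1 − m) y²))` is continuous in `u` on
`[0, 1]`, vanishes at `u = 0` and `u = 1`, and has derivative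
`g₁(u) = ½ y² (1/(√(1 − u²) √(1 − m u²))) (1/(√(1 − y²) √(1 − (1 − m) y²)))
  ((1 − 2u²) + m u² (1 − u²)/(1 − m u²))` at every `u ∈ (0, 1)` (`y, m ∈ (0, 1)`). [folklore] -/
theorem stub_legendrePotentialX :
    ∀ (y m : ℝ), y ∈ Set.Ioo (0:ℝ) 1 → m ∈ Set.Ioo (0:ℝ) 1 →
      ContinuousOn (fun u : ℝ => (1 / 2 * u * Real.sqrt (1 - u ^ 2) * y ^ 2 /
          (Real.sqrt (1 - m * u ^ 2) * Real.sqrt (1 - y ^ 2) * Real.sqrt (1 - (1 - m) * y ^ 2))))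
        (Set.Icc (0:ℝ) 1) ∧
      (1 / 2 * (0:ℝ) * Real.sqrt (1 - (0:ℝ) ^ 2) * y ^ 2 /
          (Real.sqrt (1 - m * (0:ℝ) ^ 2) * Real.sqrt (1 - y ^ 2) * Real.sqrt (1 - (1 - m) * y ^ 2)))
        = 0 ∧
      (1 / 2 * (1:ℝ) * Real.sqrt (1 - (1:ℝ) ^ 2) * y ^ 2 /
          (Real.sqrt (1 - m * (1:ℝ) ^ 2) * Real.sqrt (1 - y ^ 2) * Real.sqrt (1 - (1 - m) * y ^ 2)))
        = 0 ∧
      ∀ u ∈ Set.Ioo (0:ℝ) 1, HasDerivAt (fun v : ℝ => (1 / 2 * v * Real.sqrt (1 - v ^ 2) * y ^ 2 /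
          (Real.sqrt (1 - m * v ^ 2) * Real.sqrt (1 - y ^ 2) * Real.sqrt (1 - (1 - m) * y ^ 2))))
        (1 / 2 * y ^ 2 * (1 / (Real.sqrt (1 - u ^ 2) * Real.sqrt (1 - m * u ^ 2))) *
          (1 / (Real.sqrt (1 - y ^ 2) * Real.sqrt (1 - (1 - m) * y ^ 2))) *
          ((1 - 2 * u ^ 2) + m * u ^ 2 * (1 - u ^ 2) / (1 - m * u ^ 2))) u := by
  intro y m hy hm
  -- `G₁ = C · φ_m` with the constant `C = ½ y² / (√(1 − y²) √(1 − (1 − m) y²))`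
  have hfun : (fun v : ℝ => (1 / 2 * v * Real.sqrt (1 - v ^ 2) * y ^ 2 /
      (Real.sqrt (1 - m * v ^ 2) * Real.sqrt (1 - y ^ 2) * Real.sqrt (1 - (1 - m) * y ^ 2)))) =
      fun v : ℝ => (1 / 2 * y ^ 2 / (Real.sqrt (1 - y ^ 2) * Real.sqrt (1 - (1 - m) * y ^ 2))) *
        (v * Real.sqrt (1 - v ^ 2) / Real.sqrt (1 - m * v ^ 2)) := by
    funext v
    ring
  refine ⟨?_, by simp, by simp, ?_⟩
  · rw [hfun]
    exact continuousOn_const.mul (legendrePhi_continuousOn hm)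
  · intro u hu
    rw [hfun]
    refine ((legendrePhi_hasDerivAt hm hu).const_mul _).congr_deriv ?_
    ring

/-- **Potential `G₂`** of the Legendre certificate:
`G₂(u) = −½ x² u √(1 − u²) / (√(1 − x²) √(1 − m x²) √(1 − (1 − m) u²))` is continuous in `u` on
`[0, 1]`, vanishes at `u = 0` and `u = 1`, and has derivative
`g₂(u) = −½ x² (1/(√(1 − x²) √(1 − m x²))) (1/(√(1 − u²) √(1 − (1 − m) u²)))
  ((1 − 2u²) + (1 − m) u² (1 − u²)/(1 − (1 − m) u²))` at every `u ∈ (0, 1)` (`x, m ∈ (0, 1)`).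
[folklore] -/
theorem stub_legendrePotentialY :
    ∀ (x m : ℝ), x ∈ Set.Ioo (0:ℝ) 1 → m ∈ Set.Ioo (0:ℝ) 1 →
      ContinuousOn (fun u : ℝ => (-(1 / 2 * x ^ 2 * u * Real.sqrt (1 - u ^ 2) /
          (Real.sqrt (1 - x ^ 2) * Real.sqrt (1 - m * x ^ 2) * Real.sqrt (1 - (1 - m) * u ^ 2)))))
        (Set.Icc (0:ℝ) 1) ∧
      (-(1 / 2 * x ^ 2 * (0:ℝ) * Real.sqrt (1 - (0:ℝ) ^ 2) /
          (Real.sqrt (1 - x ^ 2) * Real.sqrt (1 - m * x ^ 2) *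
            Real.sqrt (1 - (1 - m) * (0:ℝ) ^ 2)))) = 0 ∧
      (-(1 / 2 * x ^ 2 * (1:ℝ) * Real.sqrt (1 - (1:ℝ) ^ 2) /
          (Real.sqrt (1 - x ^ 2) * Real.sqrt (1 - m * x ^ 2) *
            Real.sqrt (1 - (1 - m) * (1:ℝ) ^ 2)))) = 0 ∧
      ∀ u ∈ Set.Ioo (0:ℝ) 1, HasDerivAt (fun v : ℝ => (-(1 / 2 * x ^ 2 * v * Real.sqrt (1 - v ^ 2) /
          (Real.sqrt (1 - x ^ 2) * Real.sqrt (1 - m * x ^ 2) * Real.sqrt (1 - (1 - m) * v ^ 2)))))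
        (-(1 / 2 * x ^ 2 * (1 / (Real.sqrt (1 - x ^ 2) * Real.sqrt (1 - m * x ^ 2))) *
          (1 / (Real.sqrt (1 - u ^ 2) * Real.sqrt (1 - (1 - m) * u ^ 2))) *
          ((1 - 2 * u ^ 2) + (1 - m) * u ^ 2 * (1 - u ^ 2) / (1 - (1 - m) * u ^ 2)))) u := by
  intro x m hx hm
  have hm' : 1 - m ∈ Set.Ioo (0:ℝ) 1 := ⟨by linarith [hm.2], by linarith [hm.1]⟩
  -- `G₂ = C · φ_{1 − m}` with the constant `C = −½ x² / (√(1 − x²) √(1 − m x²))`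
  have hfun : (fun v : ℝ => (-(1 / 2 * x ^ 2 * v * Real.sqrt (1 - v ^ 2) /
      (Real.sqrt (1 - x ^ 2) * Real.sqrt (1 - m * x ^ 2) * Real.sqrt (1 - (1 - m) * v ^ 2))))) =
      fun v : ℝ => (-(1 / 2 * x ^ 2 / (Real.sqrt (1 - x ^ 2) * Real.sqrt (1 - m * x ^ 2)))) *
        (v * Real.sqrt (1 - v ^ 2) / Real.sqrt (1 - (1 - m) * v ^ 2)) := by
    funext v
    ring
  refine ⟨?_, by simp, by simp, ?_⟩
  · rw [hfun]
    exact continuousOn_const.mul (legendrePhi_continuousOn hm')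
  · intro u hu
    rw [hfun]
    refine ((legendrePhi_hasDerivAt hm' hu).const_mul _).congr_deriv ?_
    ring

end Summit.KontsevichZagierPeriods.KontsevichZagierPeriods.CompleteModGammaSectorEngine
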